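import Summits.KontsevichZagierPeriods.KontsevichZagierPeriods.Theorems.LinRedNormalFormArrangementNormalFormStubRebaseSimplePosOnePosHUPiece
import Summits.KontsevichZagierPeriods.KontsevichZagierPeriods.Theorems.LinRedNormalFormArrangementNormalFormSeparateThreeKAssembly

/-!
# Stub `stub_rebaseSimplePosOnePos` (crux `ArrangementNormalForm`, line `janus-bands`) —
part `HUFrame`: re-selecting the distinguished coordinate (`B = 2`)

Towards the residue `HU` of the one-fibre rebase over the base `(x₁, x₂, y)`. A one-fibre
arrangement datum `[{rows, lo < t < hi}, P(x, y)/∏ Λⱼ(x, y)^{Eⱼ} · 1/(t − c(x, y))]` over the FULL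
base `ℝ³` (letters `Λⱼ` arbitrary rational affine forms in `(x₁, x₂, y)`) together with a
rational base direction `d` with `d_y ≠ 0` such that
* the letter `c` and one of the two bounds are constant along `d` (`∂_d c = 0`, `∂_d G = 0`),
  and the other bound is the coordinate form `Z = y/d_y` (`RebasePos.frameZ`; it becomes the new
  distinguished coordinate),
* in the direction `d` the letters satisfy the hypotheses of the separation engine on the cell:
  every active non-constant letter is moved by `d` (`hact`), the moved active letters do not
  vanish on the cell (`hpole`), and the RATIO condition `|Λ_{j'}| ≤ C |∂_d Λⱼ · Λ_{j'} − ∂_d Λ_{j'} · Λⱼ|`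
  holds for every ordered pair of non-proportional moved active letters (`hrat`),
is congruent modulo `KZ.relations` to a `ℤ`-combination of elements of `GG 2 2 1`
(`RebasePos.good_frame`): the base change `x = A⁻¹ x̃` with `A⁻¹ = SepHigh.dirAinv d` (rule 2,
`separatePos_baseChange`; the new distinguished coordinate `ỹ` moves along `d`) puts the datum
in engine coordinates with the fibre structure of `GG 2 2 1` (letter and one bound free of `ỹ`,
the other bound equal to `ỹ`), and the engine preserves this structure
(`SepThreeK.piece_sigmaTwo_three`, part `HUPiece`). Registered as `rebaseSimplePos_goodFrame`.

References: M. Kontsevich, D. Zagier, *Periods* (2001), §1.2, rules (1b), (2).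
-/

noncomputable section

open Set MeasureTheory MvPolynomial
open Literature.NumberTheory.Transcendental

namespace Summit.KontsevichZagierPeriods.ArrangementNormalForm.JanusBands

namespace RebasePos

open SeparatePos SepHigh

section Frame

/-- The derivative `∂_d c = ∑ᵢ cᵢ dᵢ` of a full-base affine form along a rational direction. -/
def dd (c : (Fin (2 + 1) → ℚ) × ℚ) (d : Fin (2 + 1) → ℚ) : ℚ := ∑ i, c.1 i * d i

/-- The coordinate form `Z = y/d_y`: after the base change along `d` it is the new distinguished
coordinate. -/
def frameZ (d : Fin (2 + 1) → ℚ) : (Fin (2 + 1) → ℚ) × ℚ := (Pi.single (Fin.last 2) (d (Fin.last 2))⁻¹, 0)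

/-- `∂_d` is additive. -/
theorem dd_add (c c' : (Fin (2 + 1) → ℚ) × ℚ) (d : Fin (2 + 1) → ℚ) : dd (c + c') d = dd c d + dd c' d := by
  simp only [dd, Prod.fst_add, Pi.add_apply, add_mul, Finset.sum_add_distrib]

/-- `∂_d` of a difference. -/
theorem dd_sub (c c' : (Fin (2 + 1) → ℚ) × ℚ) (d : Fin (2 + 1) → ℚ) : dd (c - c') d = dd c d - dd c' d := by
  simp only [dd, Prod.fst_sub, Pi.sub_apply, sub_mul, Finset.sum_sub_distrib]

/-- `∂_d` of a multiple. -/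
theorem dd_smul (q : ℚ) (c : (Fin (2 + 1) → ℚ) × ℚ) (d : Fin (2 + 1) → ℚ) : dd (q • c) d = q * dd c d := by
  simp only [dd, Prod.smul_fst, Pi.smul_apply, smul_eq_mul, mul_assoc, Finset.mul_sum]

/-- `∂_d Z = 1`. -/
theorem dd_frameZ (d : Fin (2 + 1) → ℚ) (hd : d (Fin.last 2) ≠ 0) : dd (frameZ d) d = 1 := by
  simp [dd, frameZ, Pi.single_apply]
  exact inv_mul_cancel₀ hd

/-- The form `Z` in the new frame is the distinguished coordinate itself. -/
theorem vecMul_frameZ (d : Fin (2 + 1) → ℚ) (hd : d (Fin.last 2) ≠ 0) :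
    Matrix.vecMul (frameZ d).1 (dirAinv d) = Pi.single (Fin.last 2) 1 := by
  funext j
  simp only [frameZ, Matrix.vecMul, dotProduct, dirAinv]
  by_cases hj : j = Fin.last 2
  · subst hj
    simp [Pi.single_apply]
    exact inv_mul_cancel₀ hd
  · have hj2 : j ≠ 2 := hj
    simp [Pi.single_apply, hj2, Matrix.one_apply]

/-- `∂_d` is the last coefficient in the new frame. -/
theorem vecMul_last_eq_dd (c : (Fin (2 + 1) → ℚ) × ℚ) (d : Fin (2 + 1) → ℚ) :
    Matrix.vecMul c.1 (dirAinv d) (Fin.last 2) = dd c d :=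
  vecMul_dirAinv_last c.1 d

variable {n m' : ℕ}

/-- **Re-selecting the distinguished coordinate.** See the module docstring. -/
theorem good_frame (s : KZ.IntegralRep (2 + 1 + 1)) (M : Fin m' → (Fin (2 + 1) → ℚ) × ℚ)
    (Λ : Fin n → (Fin (2 + 1) → ℚ) × ℚ) (E : Fin n → ℕ) (P : MvPolynomial (Fin (2 + 1)) ℚ)
    (c lo hi : (Fin (2 + 1) → ℚ) × ℚ) (d : Fin (2 + 1) → ℚ) (hd : d (Fin.last 2) ≠ 0)
    (hbd : Bornology.IsBounded s.domain)
    (hdom : s.domain = gDom 2 1 m' M (fun _ => Sum.inr lo) (fun _ => Sum.inr hi))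
    (hint : EqOn s.integrand (fun z => MvPolynomial.aeval (fun i => z (Fin.castAdd 1 i)) P /
      (∏ j, affF 2 1 (Λ j) z ^ E j) * fib 2 1 (fun _ => some c) z) s.domain)
    (hc : dd c d = 0)
    (hlohi : (lo = frameZ d ∧ dd hi d = 0) ∨ (hi = frameZ d ∧ dd lo d = 0))
    (hact : ∀ j, E j ≠ 0 → (Λ j).1 ≠ 0 → dd (Λ j) d ≠ 0)
    (hpole : ∀ j, dd (Λ j) d ≠ 0 → E j ≠ 0 → ∀ z ∈ s.domain, affF 2 1 (Λ j) z ≠ 0)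
    (hrat : ∀ j j', dd (Λ j) d ≠ 0 → dd (Λ j') d ≠ 0 → E j ≠ 0 → E j' ≠ 0 →
      dd (Λ j') d • Λ j ≠ dd (Λ j) d • Λ j' → ∃ C : ℝ, ∀ z ∈ s.domain,
      |affF 2 1 (Λ j') z| ≤ C * |(dd (Λ j) d : ℝ) * affF 2 1 (Λ j') z -
        (dd (Λ j') d : ℝ) * affF 2 1 (Λ j) z|) :
    ∃ c' ∈ AddSubgroup.closure (GGset 2 2 1), KZ.of s - c' ∈ KZ.relations := by
  classical
  -- the base change along `d` (fibre untouched, no cut)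
  obtain ⟨hA', hA⟩ := dirAinv_mul_inv (n := 2) d hd
  obtain ⟨M', L', p', a', lo', hi', s', -, hL', -, ha', hlo', hhi', hΨ, hbd', hdom', hint', hrel'⟩ :=
    separatePos_baseChange (2 + 1) 1 n m' s M Λ E P (fun _ => some c) (fun _ => Sum.inr lo)
      (fun _ => Sum.inr hi) hbd hdom hint (dirAinv d)⁻¹ (dirAinv d) hA hA'
  have hform : ∀ j w, affF 2 1 (L' j) w =
      affF 2 1 (Λ j) (Fin.append (fun j => ∑ i, (dirAinv d j i : ℝ) * w (Fin.castAdd 1 i))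
        (fun i => w (Fin.natAdd (2 + 1) i)) : Fin (2 + 1 + 1) → ℝ) := fun j w => by
    rw [hL']; exact (form_sub (dirAinv d) (Λ j) w).symm
  have hlast : ∀ j, (L' j).1 (Fin.last 2) = dd (Λ j) d := fun j => by
    rw [hL']; exact vecMul_last_eq_dd _ _
  -- the engine in the new frame, with the rebased fibre structure preserved
  have key : ∃ c' ∈ AddSubgroup.closure (GGset 2 2 1), KZ.of s' - c' ∈ KZ.relations := by
    refine SepThreeK.piece_sigmaTwo_three s' M' L' E p' a' lo' hi' hbd' hdom' hint'
      (fun j he hLj => ?_) (fun j hα he w hw => ?_) (fun j j' hα hα' he he' hne => ?_)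
      (fun i c₁ hc₁ => ?_) (fun i c₁ hc₁ => ?_)
    · -- every active non-constant letter is moved by `d`
      rw [hlast]
      refine hact j he fun h0 => hLj ?_
      rw [hL', h0]
      simp
    · -- moved active letters do not vanish on the cell
      rw [hlast] at hα
      rw [hform]
      exact hpole j hα he _ ((hΨ w).1 hw)
    · -- the ratio condition
      rw [hlast] at hα hα'
      have hne' : dd (Λ j') d • Λ j ≠ dd (Λ j) d • Λ j' := fun h => by
        refine hne ?_
        rw [hlast, hlast, hL', hL']
        have h2 := congrArg
          (fun c : (Fin (2 + 1) → ℚ) × ℚ => (Matrix.vecMul c.1 (dirAinv d), c.2)) h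
        simpa only [Prod.smul_fst, Prod.smul_snd, Matrix.smul_vecMul, Prod.smul_mk] using h2
      obtain ⟨C, hC⟩ := hrat j j' hα hα' he he' hne'
      refine ⟨C, fun w hw => ?_⟩
      have h := hC _ ((hΨ w).1 hw)
      rw [hform, hform, hlast, hlast]
      exact h
    · -- the letter is free of the new distinguished coordinate
      rw [ha'] at hc₁
      simp only [Option.map_some, Option.some.injEq] at hc₁
      rw [← hc₁]
      dsimp only
      rw [vecMul_last_eq_dd, hc]
    · -- one bound is the new distinguished coordinate, the other is free of it
      rw [hlo', hhi'] at hc₁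
      simp only [Sum.map_inr, Sum.inr.injEq] at hc₁
      rcases hlohi with ⟨hl, hh⟩ | ⟨hh, hl⟩
      · rcases hc₁ with h | h
        · right
          rw [← h, hl, vecMul_frameZ d hd]
          rfl
        · left
          rw [← h]
          dsimp only
          rw [vecMul_last_eq_dd, hh]
      · rcases hc₁ with h | h
        · left
          rw [← h]
          dsimp only
          rw [vecMul_last_eq_dd, hl]
        · right
          rw [← h, hh, vecMul_frameZ d hd]
          rfl
  obtain ⟨c', hc', hr⟩ := key
  refine ⟨c', hc', ?_⟩
  have := add_mem hrel' hr
  rwa [sub_add_sub_cancel] at this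

end Frame

end RebasePos

/-- **Registered part of `stub_rebaseSimplePosOnePos` (line `janus-bands`): re-selecting the
distinguished coordinate over the base `(x₁, x₂, y)`.** A one-fibre arrangement datum over the
full base `ℝ³` whose letter and one bound are constant along a rational direction `d`
(`d_y ≠ 0`), whose other bound is `y/d_y`, and whose letters satisfy in the direction `d` the
hypotheses of the separation engine on the cell (active non-constant letters moved by `d`,
moved active letters non-vanishing, pairwise ratio conditions) is congruent modulo
`KZ.relations` to a `ℤ`-combination of elements of `GG 2 2 1` (`RebasePos.good_frame`: base
change along `d`, rule 2, then the structure-preserving engine of part `HUPiece`). -/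
theorem rebaseSimplePos_goodFrame (n m' : ℕ) (s : KZ.IntegralRep (2 + 1 + 1)) (M : Fin m' → (Fin (2 + 1) → ℚ) × ℚ) (Λ : Fin n → (Fin (2 + 1) → ℚ) × ℚ) (E : Fin n → ℕ) (P : MvPolynomial (Fin (2 + 1)) ℚ) (c lo hi : (Fin (2 + 1) → ℚ) × ℚ) (d : Fin (2 + 1) → ℚ) (hd : d (Fin.last 2) ≠ 0) (hbd : Bornology.IsBounded s.domain) (hdom : s.domain = SeparatePos.gDom 2 1 m' M (fun _ => Sum.inr lo) (fun _ => Sum.inr hi)) (hint : Set.EqOn s.integrand (fun z => MvPolynomial.aeval (fun i => z (Fin.castAdd 1 i)) P / (∏ j, SeparatePos.affF 2 1 (Λ j) z ^ E j) * SeparatePos.fib 2 1 (fun _ => some c) z) s.domain) (hc : RebasePos.dd c d = 0) (hlohi : (lo = RebasePos.frameZ d ∧ RebasePos.dd hi d = 0) ∨ (hi = RebasePos.frameZ d ∧ RebasePos.dd lo d = 0)) (hact : ∀ j, E j ≠ 0 → (Λ j).1 ≠ 0 → RebasePos.dd (Λ j) d ≠ 0) (hpole : ∀ j, RebasePos.dd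 (Λ j) d ≠ 0 → E j ≠ 0 → ∀ z ∈ s.domain, SeparatePos.affF 2 1 (Λ j) z ≠ 0) (hrat : ∀ j j', RebasePos.dd (Λ j) d ≠ 0 → RebasePos.dd (Λ j') d ≠ 0 → E j ≠ 0 → E j' ≠ 0 → RebasePos.dd (Λ j') d • Λ j ≠ RebasePos.dd (Λ j) d • Λ j' → ∃ C : ℝ, ∀ z ∈ s.domain, |SeparatePos.affF 2 1 (Λ j') z| ≤ C * |(RebasePos.dd (Λ j) d : ℝ) * SeparatePos.affF 2 1 (Λ j') z - (RebasePos.dd (Λ j') d : ℝ) * SeparatePos.affF 2 1 (Λ j) z|) : ∃ c' ∈ AddSubgroup.closure (SeparatePos.GGset 2 2 1), KZ.of s - c' ∈ KZ.relations :=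
  RebasePos.good_frame s M Λ E P c lo hi d hd hbd hdom hint hc hlohi hact hpole hrat

end Summit.KontsevichZagierPeriods.ArrangementNormalForm.JanusBands
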